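import Mathlib
import Summits.Ventures.PercRepro2.Defs
import Summits.Ventures.PercRepro2.Independence
import Summits.Ventures.PercRepro2.Harris
import Summits.Ventures.PercRepro2.Graph
import Summits.Ventures.PercRepro2.Exploration
import Summits.Ventures.PercRepro2.Events
import Summits.Ventures.PercRepro2.R2PrimeThreeReduction
import Summits.Ventures.PercRepro2.YBridge

/-!
# Identities behind the reduction `R2′(3) ⇐ (Yu1Δ) ∧ (Yu2Δ)` (blind cell PercRepro2, p1)

Roots `o, b, a₁` (light), `a₂` (heavy), `a₃` (= `a*`); `Ũ = C₁ ∪ C₂` (`UnionCluster.inU`),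
`D̃ = {a₃ ∉ Ũ}`, `PD = D̃ ∩ {C₁ ≠ C₂}`, `x | y` = `{x, y ∈ Ũ in different clusters}`
(`UnionCluster.split`); masses as in `YBridge` (`massB = mb`, `massM3 = m₃`, `splitMass = split`).

* `gap_prime_eq`: `P(b ∈ Ũ) − P(a₃ ↔ b) − P(a₃ | b) = mb − m₃` — the SC′ bracket `gap′` is the SC″
  bracket, so `c′ · gap′ = φ · (mb − m₃)`;
* `corr_eq`: `P(o | b) − P(a₃ | b, o ∈ Ũ) = split − Δ`, `Δ := P(o | a₃, o ↔ b) − P(o | a₃, a₃ ↔ b)`;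
  hence **`SC′-slack = SC″-slack + Δ`** (`proofs/LEAD-PROOFSHAPES.md` §8.9 ADDENDUM 11 (B));
* `delta_split`: `Δ = Δ_l + Δ_h` by the cluster of `o`,
  `Δ_l = P(C₁ ≠ C₂, o ∈ C₁, a₃ ∈ C₂, b ∈ C₁) − P(C₁ ≠ C₂, o ∈ C₁, a₃ ∈ C₂, b ∈ C₂)` and its mirror
  (ADDENDUM 12 (1)).
All proofs are finite set identities (`conn_trans` / `conn_symm` case analyses) plus the
two-event law of total probability.
-/

namespace Summit.Ventures.PercRepro2

open UnionCluster

section ZIdentities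

variable {V : Type*} {E : Type*} [Fintype E] [DecidableEq E] [Fintype V] [DecidableEq V]
  {R : Type*} [Field R] [LinearOrder R] [IsStrictOrderedRing R]

omit [Fintype E] [DecidableEq E] [Fintype V] [DecidableEq V] in
/-- `{a₃ ↔ b} ∩ {a₃ ∈ Ũ} = {a₃ ∈ Ũ} ∩ {b ∈ Ũ} ∩ {a₃ ↔ b}`. -/
lemma conn_inter_inU_eq (ends : E → Sym2 V) (a₁ a₂ a₃ b : V) :
    connEvent ends a₃ b ∩ inU ends a₁ a₂ a₃ =
      inU ends a₁ a₂ a₃ ∩ inU ends a₁ a₂ b ∩ connEvent ends a₃ b := by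
  ext ω
  simp only [Set.mem_inter_iff, mem_connEvent, mem_inU]
  constructor
  · rintro ⟨hab, h3⟩
    refine ⟨⟨h3, ?_⟩, hab⟩
    rcases h3 with h | h
    · exact Or.inl (conn_trans (conn_symm hab) h)
    · exact Or.inr (conn_trans (conn_symm hab) h)
  · rintro ⟨⟨h3, _⟩, hab⟩
    exact ⟨hab, h3⟩

omit [Fintype V] [DecidableEq V] in
/-- **`gap′ = mb − m₃`**: `P(b ∈ Ũ) − P(a₃ ↔ b) − P(a₃ | b) = P(b ∈ Ũ, D̃) − P(a₃ ↔ b, D̃)`. -/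
theorem gap_prime_eq (p : E → R) (ends : E → Sym2 V) (a₁ a₂ a₃ b : V) :
    prob p (inU ends a₁ a₂ b) - prob p (connEvent ends a₃ b) -
        prob p (split ends a₁ a₂ a₃ b) =
      massB p ends a₁ a₂ a₃ b - massM3 p ends a₁ a₂ a₃ b := by
  unfold massB massM3 Dtilde
  have s1 := prob_inter_add_prob_inter_compl p (inU ends a₁ a₂ b) (inU ends a₁ a₂ a₃)
  have s2 := prob_inter_add_prob_inter_compl p (connEvent ends a₃ b) (inU ends a₁ a₂ a₃)
  have s3 := prob_inter_add_prob_inter_compl p (inU ends a₁ a₂ a₃ ∩ inU ends a₁ a₂ b)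
    (connEvent ends a₃ b)
  rw [conn_inter_inU_eq] at s2
  have e : split ends a₁ a₂ a₃ b =
      inU ends a₁ a₂ a₃ ∩ inU ends a₁ a₂ b ∩ (connEvent ends a₃ b)ᶜ := rfl
  rw [e, Set.inter_comm (inU ends a₁ a₂ b) (inU ends a₁ a₂ a₃)] at *
  linarith

omit [Fintype E] [DecidableEq E] [Fintype V] [DecidableEq V] in
/-- `{o | b} ∩ {a₃ ∈ Ũ}` splits by the cluster of `a₃`: `{o | a₃, a₃ ↔ b} ⊔ {a₃ | b, a₃ ↔ o}`. -/
lemma split_ob_inter_inU (ends : E → Sym2 V) (o a₁ a₂ a₃ b : V) :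
    split ends a₁ a₂ o b ∩ inU ends a₁ a₂ a₃ =
      (split ends a₁ a₂ o a₃ ∩ connEvent ends a₃ b) ∪
        (split ends a₁ a₂ a₃ b ∩ connEvent ends a₃ o) := by
  ext ω
  simp only [split, Set.mem_inter_iff, Set.mem_union, Set.mem_compl_iff, mem_connEvent, mem_inU]
  constructor
  · rintro ⟨⟨⟨ho, hb⟩, hob⟩, h3⟩
    -- `a₃ ∈ Ũ`: it sits with `b` or with `o` or with neither; "neither" is impossible
    by_cases h3b : Conn ends ω a₃ b
    · exact Or.inl ⟨⟨⟨ho, h3⟩, fun h => hob (conn_trans h h3b)⟩, h3b⟩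
    · by_cases h3o : Conn ends ω a₃ o
      · exact Or.inr ⟨⟨⟨h3, hb⟩, h3b⟩, h3o⟩
      · exfalso
        -- `o`, `b`, `a₃` all in `Ũ = C₁ ∪ C₂`, pairwise disconnected: impossible (two clusters)
        rcases ho with ho | ho <;> rcases hb with hb | hb <;> rcases h3 with h3 | h3
        · exact hob (conn_trans ho (conn_symm hb))
        · exact hob (conn_trans ho (conn_symm hb))
        · exact h3o (conn_trans h3 (conn_symm ho))
        · exact h3b (conn_trans h3 (conn_symm hb))
        · exact h3b (conn_trans h3 (conn_symm hb))
        · exact h3o (conn_trans h3 (conn_symm ho))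
        · exact hob (conn_trans ho (conn_symm hb))
        · exact hob (conn_trans ho (conn_symm hb))
  · rintro (⟨⟨⟨ho, h3⟩, ho3⟩, h3b⟩ | ⟨⟨⟨h3, hb⟩, h3b⟩, h3o⟩)
    · refine ⟨⟨⟨ho, ?_⟩, fun h => ho3 (conn_trans h (conn_symm h3b))⟩, h3⟩
      rcases h3 with h | h
      · exact Or.inl (conn_trans (conn_symm h3b) h)
      · exact Or.inr (conn_trans (conn_symm h3b) h)
    · refine ⟨⟨⟨?_, hb⟩, fun h => h3b (conn_trans h3o h)⟩, h3⟩
      rcases h3 with h | h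
      · exact Or.inl (conn_trans (conn_symm h3o) h)
      · exact Or.inr (conn_trans (conn_symm h3o) h)

omit [Fintype E] [DecidableEq E] [Fintype V] [DecidableEq V] in
/-- `{a₃ | b} ∩ {o ∈ Ũ}` splits by the cluster of `o`: `{a₃ | b, a₃ ↔ o} ⊔ {o | a₃, o ↔ b}`. -/
lemma split_3b_inter_inU (ends : E → Sym2 V) (o a₁ a₂ a₃ b : V) :
    split ends a₁ a₂ a₃ b ∩ inU ends a₁ a₂ o =
      (split ends a₁ a₂ a₃ b ∩ connEvent ends a₃ o) ∪
        (split ends a₁ a₂ o a₃ ∩ connEvent ends o b) := by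
  ext ω
  simp only [split, Set.mem_inter_iff, Set.mem_union, Set.mem_compl_iff, mem_connEvent, mem_inU]
  constructor
  · rintro ⟨⟨⟨h3, hb⟩, h3b⟩, ho⟩
    by_cases h3o : Conn ends ω a₃ o
    · exact Or.inl ⟨⟨⟨h3, hb⟩, h3b⟩, h3o⟩
    · by_cases hob : Conn ends ω o b
      · exact Or.inr ⟨⟨⟨ho, h3⟩, fun h => h3o (conn_symm h)⟩, hob⟩
      · exfalso
        rcases ho with ho | ho <;> rcases hb with hb | hb <;> rcases h3 with h3 | h3
        · exact hob (conn_trans ho (conn_symm hb))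
        · exact hob (conn_trans ho (conn_symm hb))
        · exact h3o (conn_trans h3 (conn_symm ho))
        · exact h3b (conn_trans h3 (conn_symm hb))
        · exact h3b (conn_trans h3 (conn_symm hb))
        · exact h3o (conn_trans h3 (conn_symm ho))
        · exact hob (conn_trans ho (conn_symm hb))
        · exact hob (conn_trans ho (conn_symm hb))
  · rintro (⟨⟨⟨h3, hb⟩, h3b⟩, h3o⟩ | ⟨⟨⟨ho, h3⟩, ho3⟩, hob⟩)
    · refine ⟨⟨⟨h3, hb⟩, h3b⟩, ?_⟩
      rcases h3 with h | h
      · exact Or.inl (conn_trans (conn_symm h3o) h)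
      · exact Or.inr (conn_trans (conn_symm h3o) h)
    · refine ⟨⟨⟨h3, ?_⟩, fun h => ho3 (conn_trans hob (conn_symm h))⟩, ho⟩
      rcases ho with h | h
      · exact Or.inl (conn_trans (conn_symm hob) h)
      · exact Or.inr (conn_trans (conn_symm hob) h)

omit [Fintype E] [DecidableEq E] [Fintype V] [DecidableEq V] in
/-- `{o | b} ∩ D̃` is the disjoint union of the two `PD` split cells. -/
lemma split_ob_inter_Dtilde (ends : E → Sym2 V) (o a₁ a₂ a₃ b : V) :
    split ends a₁ a₂ o b ∩ Dtilde ends a₁ a₂ a₃ =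
      (PDEvent ends a₁ a₂ a₃ ∩ connEvent ends a₁ o ∩ connEvent ends a₂ b) ∪
        (PDEvent ends a₁ a₂ a₃ ∩ connEvent ends a₂ o ∩ connEvent ends a₁ b) := by
  ext ω
  simp only [split, PDEvent, Dtilde, Set.mem_inter_iff, Set.mem_union, Set.mem_compl_iff,
    mem_connEvent, mem_inU, not_or]
  constructor
  · rintro ⟨⟨⟨ho, hb⟩, hob⟩, h3⟩
    rcases ho with ho | ho <;> rcases hb with hb | hb
    · exact absurd (conn_trans ho (conn_symm hb)) hob
    · exact Or.inl ⟨⟨⟨fun h => hob (conn_trans ho (conn_trans h (conn_symm hb))), h3⟩,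
        conn_symm ho⟩, conn_symm hb⟩
    · exact Or.inr ⟨⟨⟨fun h => hob (conn_trans ho (conn_trans (conn_symm h) (conn_symm hb))), h3⟩,
        conn_symm ho⟩, conn_symm hb⟩
    · exact absurd (conn_trans ho (conn_symm hb)) hob
  · rintro (⟨⟨⟨h12, h3⟩, ho⟩, hb⟩ | ⟨⟨⟨h12, h3⟩, ho⟩, hb⟩)
    · exact ⟨⟨⟨Or.inl (conn_symm ho), Or.inr (conn_symm hb)⟩,
        fun h => h12 (conn_trans ho (conn_trans h (conn_symm hb)))⟩, h3⟩
    · exact ⟨⟨⟨Or.inr (conn_symm ho), Or.inl (conn_symm hb)⟩,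
        fun h => h12 (conn_trans hb (conn_trans (conn_symm h) (conn_symm ho)))⟩, h3⟩

omit [Fintype E] [DecidableEq E] [Fintype V] [DecidableEq V] in
/-- The two `PD` split cells are disjoint. -/
lemma PD_cells_disjoint (ends : E → Sym2 V) (o a₁ a₂ a₃ b : V) :
    Disjoint (PDEvent ends a₁ a₂ a₃ ∩ connEvent ends a₁ o ∩ connEvent ends a₂ b)
      (PDEvent ends a₁ a₂ a₃ ∩ connEvent ends a₂ o ∩ connEvent ends a₁ b) := by
  rw [Set.disjoint_left]
  rintro ω ⟨⟨⟨h12, _⟩, h1o⟩, _⟩ ⟨⟨_, h2o⟩, _⟩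
  exact h12 (conn_trans h1o (conn_symm h2o))

omit [Fintype E] [DecidableEq E] [Fintype V] [DecidableEq V] in
/-- `{o | a₃, a₃ ↔ b}` and `{a₃ | b, a₃ ↔ o}` are disjoint (`o ↮ a₃` vs `a₃ ↔ o`). -/
lemma cells3_disjoint (ends : E → Sym2 V) (o a₁ a₂ a₃ b : V) :
    Disjoint (split ends a₁ a₂ o a₃ ∩ connEvent ends a₃ b)
      (split ends a₁ a₂ a₃ b ∩ connEvent ends a₃ o) := by
  rw [Set.disjoint_left]
  rintro ω ⟨⟨_, ho3⟩, _⟩ ⟨_, h3o⟩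
  exact ho3 (conn_symm h3o)

omit [Fintype E] [DecidableEq E] [Fintype V] [DecidableEq V] in
/-- `{a₃ | b, a₃ ↔ o}` and `{o | a₃, o ↔ b}` are disjoint. -/
lemma cells3_disjoint' (ends : E → Sym2 V) (o a₁ a₂ a₃ b : V) :
    Disjoint (split ends a₁ a₂ a₃ b ∩ connEvent ends a₃ o)
      (split ends a₁ a₂ o a₃ ∩ connEvent ends o b) := by
  rw [Set.disjoint_left]
  rintro ω ⟨_, h3o⟩ ⟨⟨_, ho3⟩, _⟩
  exact ho3 (conn_symm h3o)

omit [Fintype V] [DecidableEq V] in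
/-- **`corr = split − Δ`**: `P(o | b) − P(a₃ | b, o ∈ Ũ) = split − (P(o | a₃, o ↔ b) − P(o | a₃, a₃ ↔ b))`. -/
theorem corr_eq (p : E → R) (ends : E → Sym2 V) (o a₁ a₂ a₃ b : V) :
    prob p (split ends a₁ a₂ o b) - prob p (split ends a₁ a₂ a₃ b ∩ inU ends a₁ a₂ o) =
      splitMass p ends o a₁ a₂ a₃ b -
        (prob p (split ends a₁ a₂ o a₃ ∩ connEvent ends o b) -
          prob p (split ends a₁ a₂ o a₃ ∩ connEvent ends a₃ b)) := by
  unfold splitMass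
  have s1 := prob_inter_add_prob_inter_compl p (split ends a₁ a₂ o b) (inU ends a₁ a₂ a₃)
  have e1 : split ends a₁ a₂ o b ∩ (inU ends a₁ a₂ a₃)ᶜ =
      split ends a₁ a₂ o b ∩ Dtilde ends a₁ a₂ a₃ := rfl
  rw [e1, split_ob_inter_Dtilde, prob_union_of_disjoint p (PD_cells_disjoint ends o a₁ a₂ a₃ b),
    split_ob_inter_inU, prob_union_of_disjoint p (cells3_disjoint ends o a₁ a₂ a₃ b)] at s1
  rw [split_3b_inter_inU, prob_union_of_disjoint p (cells3_disjoint' ends o a₁ a₂ a₃ b)]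
  linarith

omit [Fintype E] [DecidableEq E] [Fintype V] [DecidableEq V] in
/-- `{o | a₃, o ↔ b}` by the cluster of `o`: `o ∈ C₁` (then `a₃ ∈ C₂`, `b ∈ C₁`) or `o ∈ C₂`. -/
lemma split_o3_ob_eq (ends : E → Sym2 V) (o a₁ a₂ a₃ b : V) :
    split ends a₁ a₂ o a₃ ∩ connEvent ends o b =
      ((connEvent ends a₁ a₂)ᶜ ∩ connEvent ends a₁ o ∩ connEvent ends a₂ a₃ ∩ connEvent ends a₁ b) ∪
        ((connEvent ends a₁ a₂)ᶜ ∩ connEvent ends a₂ o ∩ connEvent ends a₁ a₃ ∩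
          connEvent ends a₂ b) := by
  ext ω
  simp only [split, Set.mem_inter_iff, Set.mem_union, Set.mem_compl_iff, mem_connEvent, mem_inU]
  constructor
  · rintro ⟨⟨⟨ho, h3⟩, ho3⟩, hob⟩
    rcases ho with ho | ho <;> rcases h3 with h3 | h3
    · exact absurd (conn_trans ho (conn_symm h3)) ho3
    · exact Or.inl ⟨⟨⟨fun h => ho3 (conn_trans ho (conn_trans h (conn_symm h3))), conn_symm ho⟩,
        conn_symm h3⟩, conn_trans (conn_symm ho) hob⟩
    · exact Or.inr ⟨⟨⟨fun h => ho3 (conn_trans ho (conn_trans (conn_symm h) (conn_symm h3))),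
        conn_symm ho⟩, conn_symm h3⟩, conn_trans (conn_symm ho) hob⟩
    · exact absurd (conn_trans ho (conn_symm h3)) ho3
  · rintro (⟨⟨⟨h12, h1o⟩, h23⟩, h1b⟩ | ⟨⟨⟨h12, h2o⟩, h13⟩, h2b⟩)
    · exact ⟨⟨⟨Or.inl (conn_symm h1o), Or.inr (conn_symm h23)⟩,
        fun h => h12 (conn_trans h1o (conn_trans h (conn_symm h23)))⟩,
        conn_trans (conn_symm h1o) h1b⟩
    · exact ⟨⟨⟨Or.inr (conn_symm h2o), Or.inl (conn_symm h13)⟩,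
        fun h => h12 (conn_trans h13 (conn_trans (conn_symm h) (conn_symm h2o)))⟩,
        conn_trans (conn_symm h2o) h2b⟩

omit [Fintype E] [DecidableEq E] [Fintype V] [DecidableEq V] in
/-- `{o | a₃, a₃ ↔ b}` by the cluster of `o`. -/
lemma split_o3_3b_eq (ends : E → Sym2 V) (o a₁ a₂ a₃ b : V) :
    split ends a₁ a₂ o a₃ ∩ connEvent ends a₃ b =
      ((connEvent ends a₁ a₂)ᶜ ∩ connEvent ends a₁ o ∩ connEvent ends a₂ a₃ ∩ connEvent ends a₂ b) ∪
        ((connEvent ends a₁ a₂)ᶜ ∩ connEvent ends a₂ o ∩ connEvent ends a₁ a₃ ∩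
          connEvent ends a₁ b) := by
  ext ω
  simp only [split, Set.mem_inter_iff, Set.mem_union, Set.mem_compl_iff, mem_connEvent, mem_inU]
  constructor
  · rintro ⟨⟨⟨ho, h3⟩, ho3⟩, h3b⟩
    rcases ho with ho | ho <;> rcases h3 with h3 | h3
    · exact absurd (conn_trans ho (conn_symm h3)) ho3
    · exact Or.inl ⟨⟨⟨fun h => ho3 (conn_trans ho (conn_trans h (conn_symm h3))), conn_symm ho⟩,
        conn_symm h3⟩, conn_trans (conn_symm h3) h3b⟩
    · exact Or.inr ⟨⟨⟨fun h => ho3 (conn_trans ho (conn_trans (conn_symm h) (conn_symm h3))),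
        conn_symm ho⟩, conn_symm h3⟩, conn_trans (conn_symm h3) h3b⟩
    · exact absurd (conn_trans ho (conn_symm h3)) ho3
  · rintro (⟨⟨⟨h12, h1o⟩, h23⟩, h2b⟩ | ⟨⟨⟨h12, h2o⟩, h13⟩, h1b⟩)
    · exact ⟨⟨⟨Or.inl (conn_symm h1o), Or.inr (conn_symm h23)⟩,
        fun h => h12 (conn_trans h1o (conn_trans h (conn_symm h23)))⟩,
        conn_trans (conn_symm h23) h2b⟩
    · exact ⟨⟨⟨Or.inr (conn_symm h2o), Or.inl (conn_symm h13)⟩,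
        fun h => h12 (conn_trans h13 (conn_trans (conn_symm h) (conn_symm h2o)))⟩,
        conn_trans (conn_symm h13) h1b⟩

omit [Fintype E] [DecidableEq E] [Fintype V] [DecidableEq V] in
/-- Cells with `o ∈ C₁` and with `o ∈ C₂` (under `C₁ ≠ C₂`) are disjoint. -/
lemma o_cells_disjoint (ends : E → Sym2 V) (o a₁ a₂ a₃ b x y : V) :
    Disjoint ((connEvent ends a₁ a₂)ᶜ ∩ connEvent ends a₁ o ∩ connEvent ends a₂ a₃ ∩
        connEvent ends x b)
      ((connEvent ends a₁ a₂)ᶜ ∩ connEvent ends a₂ o ∩ connEvent ends a₁ a₃ ∩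
        connEvent ends y b) := by
  rw [Set.disjoint_left]
  rintro ω ⟨⟨⟨h12, h1o⟩, _⟩, _⟩ ⟨⟨⟨_, h2o⟩, _⟩, _⟩
  exact h12 (conn_trans h1o (conn_symm h2o))

omit [Fintype V] [DecidableEq V] [LinearOrder R] [IsStrictOrderedRing R] in
/-- **`Δ = Δ_l + Δ_h`** (ADDENDUM 12 (1)). -/
theorem delta_split (p : E → R) (ends : E → Sym2 V) (o a₁ a₂ a₃ b : V) :
    prob p (split ends a₁ a₂ o a₃ ∩ connEvent ends o b) -
        prob p (split ends a₁ a₂ o a₃ ∩ connEvent ends a₃ b) =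
      (prob p ((connEvent ends a₁ a₂)ᶜ ∩ connEvent ends a₁ o ∩ connEvent ends a₂ a₃ ∩
            connEvent ends a₁ b) -
          prob p ((connEvent ends a₁ a₂)ᶜ ∩ connEvent ends a₁ o ∩ connEvent ends a₂ a₃ ∩
            connEvent ends a₂ b)) +
        (prob p ((connEvent ends a₁ a₂)ᶜ ∩ connEvent ends a₂ o ∩ connEvent ends a₁ a₃ ∩
            connEvent ends a₂ b) -
          prob p ((connEvent ends a₁ a₂)ᶜ ∩ connEvent ends a₂ o ∩ connEvent ends a₁ a₃ ∩
            connEvent ends a₁ b)) := by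
  rw [split_o3_ob_eq, split_o3_3b_eq,
    prob_union_of_disjoint p (o_cells_disjoint ends o a₁ a₂ a₃ b a₁ a₂),
    prob_union_of_disjoint p (o_cells_disjoint ends o a₁ a₂ a₃ b a₂ a₁)]
  ring

end ZIdentities

end Summit.Ventures.PercRepro2
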